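import Summits.QuantumFields.BalabanUV.Beta.EriceFlowEnclosureBorelTransform
import Summits.QuantumFields.BalabanUV.Beta.EriceFlowEnclosureBorelContour

/-!
# Beta / EriceFlowEnclosureBorelTransformDeriv — DERIVATIVES OF THE BOREL TRANSFORM ON THE LINE: the Bromwich integral
# `J[G](t) = ∫_ℝ e^{t(c+is)} G(c+is) ds` (real `t`, abscissa `c > 0`) is differentiable in `t` with `J[G]′ = J[w·G]` as soon as
# `G` and `w·G` are `O(‖w‖⁻²)` on the line, and `J[G]^{(k)} = J[w^k·G]` under the bounds up to `w^{k+1}G` — the first brick of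
# Nevanlinna's theorem in the DISC ∕ STRIP form (bflow-p3 gen 39, exploratory MODULE 36a over 34c; Mathlib + tree only)

HONEST FRAMING (page 1 of everything the β sub-cell writes): discharging `BetaPertH` makes Bałaban's UV stability UNCONDITIONAL — a
real constructive-QFT result; it is NOT the continuum limit and NOT the Clay problem.  HONEST DEPENDENCY (cell reorg 2026-08-19,
verbatim): «continuum YM on T⁴ ⇐ BetaPertH ∧ nine spine estimates (0/9 proved); BetaPertH ⇐ (D1) ∧ (D4) ∧ CAP+tail; G-an2-4 gates
asym, D1 and NE2/3/4.»  THIS MODULE DISCHARGES NOTHING: [folklore] differentiation under the integral sign (Mathlib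
`hasDerivAt_integral_of_dominated_loc_of_deriv_le`) for the Bromwich line integral of 34c.

SOURCE (shapes only).  [Rivasseau1991] Thm I.5.1 pp. 55–56 (Nevanlinna–Sokal, disc∕strip form); [LodayRichaud2016] Thm 5.3.9.

WHAT THIS FILE PROVES (0 sorry, 0 def).  `hasDerivAt_cexp_real_mul`, `integrable_line_of_bound` (`‖c+is‖² = c²+s²` is 34b `norm_sq_line`), HEADLINE **`hasDerivAt_line`**:
`‖G(c+is)‖ ≤ M₀∕(c²+s²)` and `‖(c+is)G(c+is)‖ ≤ M₁∕(c²+s²)` for all `s` (`c > 0`, `s ↦ G(c+is)` continuous) ⟹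
`HasDerivAt (t ↦ ∫ e^{t(c+is)}G(c+is)ds) (∫ e^{t(c+is)}(c+is)G(c+is)ds) t`; **`iteratedDeriv_line`**: under the bounds for
`w^jG`, `j ≤ k`: `iteratedDeriv j (t ↦ ∫ e^{t(c+is)}G(c+is)ds) t = ∫ e^{t(c+is)}(c+is)^jG(c+is)ds` for `j ≤ k`.
-/

namespace Summit.QuantumFields.BalabanUV.Beta.EriceFlowEnclosureBorelTransformDeriv

open Set Filter Topology MeasureTheory Metric Complex
open scoped Real
open Summit.QuantumFields.BalabanUV.Beta.EriceFlowEnclosureBorelTransform (integrable_inv_sq_add_sq norm_sq_sub_mul_I)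
open Summit.QuantumFields.BalabanUV.Beta.EriceFlowEnclosureBorelContour (norm_sq_line)

noncomputable section

/-- `d∕dt e^{t·w} = w·e^{t·w}` for real `t`. [folklore] -/
theorem hasDerivAt_cexp_real_mul (w : ℂ) (t : ℝ) :
    HasDerivAt (fun t : ℝ => cexp ((t : ℂ) * w)) (cexp ((t : ℂ) * w) * w) t := by
  have h : HasDerivAt (fun z : ℂ => cexp (z * w)) (cexp ((t : ℂ) * w) * w) (t : ℂ) := by
    simpa using ((hasDerivAt_id (t : ℂ)).mul_const w).cexp
  exact h.comp_ofReal

/-- Integrability of `s ↦ e^{t(c+is)}·H(s)` on `ℝ` from continuity and `‖H s‖ ≤ D∕(c²+s²)` (`c > 0`). [folklore] -/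
theorem integrable_line_of_bound {H : ℝ → ℂ} {c D : ℝ} (hc : 0 < c) (hH : Continuous H)
    (hHb : ∀ s : ℝ, ‖H s‖ ≤ D / (c ^ 2 + s ^ 2)) (t : ℝ) :
    Integrable fun s : ℝ => cexp ((t : ℂ) * ((c : ℂ) + (s : ℂ) * I)) * H s := by
  have hcont : Continuous fun s : ℝ => cexp ((t : ℂ) * ((c : ℂ) + (s : ℂ) * I)) * H s :=
    (by fun_prop : Continuous fun s : ℝ => cexp ((t : ℂ) * ((c : ℂ) + (s : ℂ) * I))).mul hH
  refine Integrable.mono' ((integrable_inv_sq_add_sq hc).const_mul (Real.exp (t * c) * D)) hcont.aestronglyMeasurable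
    (Eventually.of_forall fun s => ?_)
  rw [norm_mul, Complex.norm_exp]
  have hre : ((t : ℂ) * ((c : ℂ) + (s : ℂ) * I)).re = t * c := by simp [Complex.mul_re]
  rw [hre]
  calc Real.exp (t * c) * ‖H s‖ ≤ Real.exp (t * c) * (D / (c ^ 2 + s ^ 2)) :=
        mul_le_mul_of_nonneg_left (hHb s) (Real.exp_pos _).le
    _ = Real.exp (t * c) * D * (c ^ 2 + s ^ 2)⁻¹ := by rw [div_eq_mul_inv]; ring

/-- **DIFFERENTIATION UNDER THE BROMWICH INTEGRAL.**  `c > 0`, `s ↦ G(c+is)` continuous, `‖G(c+is)‖ ≤ M₀∕(c²+s²)` and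
`‖(c+is)·G(c+is)‖ ≤ M₁∕(c²+s²)` for all real `s` ⟹ `t ↦ ∫_ℝ e^{t(c+is)}G(c+is)ds` has derivative `∫_ℝ e^{t(c+is)}(c+is)G(c+is)ds`
at every real `t` (domination on `|t′ − t| < 1` by `e^{(t+1)c}M₁∕(c²+s²)`). [folklore] -/
theorem hasDerivAt_line {G : ℂ → ℂ} {c M₀ M₁ : ℝ} (hc : 0 < c) (hGc : Continuous fun s : ℝ => G ((c : ℂ) + (s : ℂ) * I))
    (hGb : ∀ s : ℝ, ‖G ((c : ℂ) + (s : ℂ) * I)‖ ≤ M₀ / (c ^ 2 + s ^ 2))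
    (hGb' : ∀ s : ℝ, ‖((c : ℂ) + (s : ℂ) * I) * G ((c : ℂ) + (s : ℂ) * I)‖ ≤ M₁ / (c ^ 2 + s ^ 2)) (t : ℝ) :
    HasDerivAt (fun t : ℝ => ∫ s : ℝ, cexp ((t : ℂ) * ((c : ℂ) + (s : ℂ) * I)) * G ((c : ℂ) + (s : ℂ) * I))
      (∫ s : ℝ, cexp ((t : ℂ) * ((c : ℂ) + (s : ℂ) * I)) * (((c : ℂ) + (s : ℂ) * I) * G ((c : ℂ) + (s : ℂ) * I))) t := by
  set F : ℝ → ℝ → ℂ := fun t s => cexp ((t : ℂ) * ((c : ℂ) + (s : ℂ) * I)) * G ((c : ℂ) + (s : ℂ) * I) with hF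
  set F' : ℝ → ℝ → ℂ := fun t s =>
    cexp ((t : ℂ) * ((c : ℂ) + (s : ℂ) * I)) * (((c : ℂ) + (s : ℂ) * I) * G ((c : ℂ) + (s : ℂ) * I)) with hF'
  have hM₁ : 0 ≤ M₁ := by
    have h := hGb' 0
    have hpos : 0 < c ^ 2 + (0 : ℝ) ^ 2 := by positivity
    exact (div_nonneg_iff.mp ((norm_nonneg _).trans h)).elim (fun h => h.1) fun h => absurd h.2 (not_le.mpr hpos)
  have hline : Continuous fun s : ℝ => (c : ℂ) + (s : ℂ) * I := by fun_prop
  have hcont' : Continuous fun s : ℝ => ((c : ℂ) + (s : ℂ) * I) * G ((c : ℂ) + (s : ℂ) * I) := hline.mul hGc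
  have hFc : ∀ t' : ℝ, Continuous (F t') := fun t' =>
    (by fun_prop : Continuous fun s : ℝ => cexp ((t' : ℂ) * ((c : ℂ) + (s : ℂ) * I))).mul hGc
  have hF'c : Continuous (F' t) :=
    (by fun_prop : Continuous fun s : ℝ => cexp ((t : ℂ) * ((c : ℂ) + (s : ℂ) * I))).mul hcont'
  have h := hasDerivAt_integral_of_dominated_loc_of_deriv_le (μ := (volume : Measure ℝ)) (F := F) (F' := F') (x₀ := t)
    (s := ball t 1) (bound := fun s : ℝ => Real.exp ((t + 1) * c) * M₁ * (c ^ 2 + s ^ 2)⁻¹) (ball_mem_nhds t one_pos)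
    (Eventually.of_forall fun t' => (hFc t').aestronglyMeasurable)
    (integrable_line_of_bound hc hGc hGb t) hF'c.aestronglyMeasurable
    (Eventually.of_forall fun s t' ht' => ?_)
    (((integrable_inv_sq_add_sq hc).const_mul (Real.exp ((t + 1) * c) * M₁)).congr ?_)
    (Eventually.of_forall fun s t' _ => ?_)
  · exact h.2
  · -- domination
    rw [mem_ball, Real.dist_eq] at ht'
    have ht'le : t' ≤ t + 1 := by linarith [(abs_lt.mp ht').2]
    simp only [hF']
    rw [norm_mul, Complex.norm_exp]
    have hre : ((t' : ℂ) * ((c : ℂ) + (s : ℂ) * I)).re = t' * c := by simp [Complex.mul_re]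
    rw [hre]
    calc Real.exp (t' * c) * ‖((c : ℂ) + (s : ℂ) * I) * G ((c : ℂ) + (s : ℂ) * I)‖
        ≤ Real.exp ((t + 1) * c) * (M₁ / (c ^ 2 + s ^ 2)) := by
          gcongr
          · exact hGb' s
      _ = Real.exp ((t + 1) * c) * M₁ * (c ^ 2 + s ^ 2)⁻¹ := by rw [div_eq_mul_inv]; ring
  · exact Eventually.of_forall fun s => rfl
  · simp only [hF, hF']
    have hd := (hasDerivAt_cexp_real_mul ((c : ℂ) + (s : ℂ) * I) t').mul_const (G ((c : ℂ) + (s : ℂ) * I))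
    simpa [mul_assoc] using hd

/-- **ITERATED DERIVATIVES UNDER THE BROMWICH INTEGRAL**: if `‖(c+is)^j·G(c+is)‖ ≤ M_j∕(c²+s²)` for all `s` and all `j ≤ k`
(`c > 0`, `s ↦ G(c+is)` continuous), then for every `j ≤ k`:
`iteratedDeriv j (t ↦ ∫_ℝ e^{t(c+is)}G(c+is)ds) = (t ↦ ∫_ℝ e^{t(c+is)}(c+is)^jG(c+is)ds)` (induction on `j` with `hasDerivAt_line`
applied to `w^jG`); in particular the `j`-th derivative exists everywhere for `j < k` (`hasDerivAt_iteratedDeriv_line`). [folklore] -/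
theorem iteratedDeriv_line {G : ℂ → ℂ} {c : ℝ} {M : ℕ → ℝ} {k : ℕ} (hc : 0 < c)
    (hGc : Continuous fun s : ℝ => G ((c : ℂ) + (s : ℂ) * I))
    (hGb : ∀ j : ℕ, j ≤ k → ∀ s : ℝ, ‖((c : ℂ) + (s : ℂ) * I) ^ j * G ((c : ℂ) + (s : ℂ) * I)‖ ≤ M j / (c ^ 2 + s ^ 2))
    {j : ℕ} (hj : j ≤ k) :
    iteratedDeriv j (fun t : ℝ => ∫ s : ℝ, cexp ((t : ℂ) * ((c : ℂ) + (s : ℂ) * I)) * G ((c : ℂ) + (s : ℂ) * I)) =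
      fun t : ℝ => ∫ s : ℝ, cexp ((t : ℂ) * ((c : ℂ) + (s : ℂ) * I)) * (((c : ℂ) + (s : ℂ) * I) ^ j * G ((c : ℂ) + (s : ℂ) * I)) := by
  induction j with
  | zero => funext t; simp
  | succ j ih =>
    have hj' : j ≤ k := Nat.le_of_succ_le hj
    rw [iteratedDeriv_succ, ih hj']
    -- `hasDerivAt_line` for `w^j G`
    have hline : Continuous fun s : ℝ => (c : ℂ) + (s : ℂ) * I := by fun_prop
    have hc' : Continuous fun s : ℝ => ((c : ℂ) + (s : ℂ) * I) ^ j * G ((c : ℂ) + (s : ℂ) * I) := (hline.pow j).mul hGc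
    have hb0 : ∀ s : ℝ, ‖((c : ℂ) + (s : ℂ) * I) ^ j * G ((c : ℂ) + (s : ℂ) * I)‖ ≤ M j / (c ^ 2 + s ^ 2) :=
      hGb j (by omega)
    have hb1 : ∀ s : ℝ, ‖((c : ℂ) + (s : ℂ) * I) * (((c : ℂ) + (s : ℂ) * I) ^ j * G ((c : ℂ) + (s : ℂ) * I))‖ ≤
        M (j + 1) / (c ^ 2 + s ^ 2) := by
      intro s
      have h := hGb (j + 1) (by omega) s
      rwa [pow_succ, mul_comm (((c : ℂ) + (s : ℂ) * I) ^ j) ((c : ℂ) + (s : ℂ) * I), mul_assoc] at h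
    funext t
    have hd := hasDerivAt_line (G := fun w => w ^ j * G w) hc hc' hb0 hb1 t
    rw [hd.deriv]
    refine integral_congr_ae (Eventually.of_forall fun s => ?_)
    simp only [pow_succ]
    ring

/-- Under the bounds for `w^jG`, `j ≤ k`, every iterated derivative of order `j < k` of the Bromwich integral is differentiable
(with derivative the next one). [folklore] -/
theorem differentiable_iteratedDeriv_line {G : ℂ → ℂ} {c : ℝ} {M : ℕ → ℝ} {k : ℕ} (hc : 0 < c)
    (hGc : Continuous fun s : ℝ => G ((c : ℂ) + (s : ℂ) * I))
    (hGb : ∀ j : ℕ, j ≤ k → ∀ s : ℝ, ‖((c : ℂ) + (s : ℂ) * I) ^ j * G ((c : ℂ) + (s : ℂ) * I)‖ ≤ M j / (c ^ 2 + s ^ 2))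
    {j : ℕ} (hj : j < k) :
    Differentiable ℝ (iteratedDeriv j
      (fun t : ℝ => ∫ s : ℝ, cexp ((t : ℂ) * ((c : ℂ) + (s : ℂ) * I)) * G ((c : ℂ) + (s : ℂ) * I))) := by
  rw [iteratedDeriv_line hc hGc hGb hj.le]
  have hline : Continuous fun s : ℝ => (c : ℂ) + (s : ℂ) * I := by fun_prop
  have hc' : Continuous fun s : ℝ => ((c : ℂ) + (s : ℂ) * I) ^ j * G ((c : ℂ) + (s : ℂ) * I) := (hline.pow j).mul hGc
  have hb1 : ∀ s : ℝ, ‖((c : ℂ) + (s : ℂ) * I) * (((c : ℂ) + (s : ℂ) * I) ^ j * G ((c : ℂ) + (s : ℂ) * I))‖ ≤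
      M (j + 1) / (c ^ 2 + s ^ 2) := by
    intro s
    have h := hGb (j + 1) (by omega) s
    rwa [pow_succ, mul_comm (((c : ℂ) + (s : ℂ) * I) ^ j) ((c : ℂ) + (s : ℂ) * I), mul_assoc] at h
  intro t
  exact (hasDerivAt_line (G := fun w => w ^ j * G w) hc hc' (hGb j hj.le) hb1 t).differentiableAt

/-- Hence the Bromwich integral is `C^j` for every `j < k` under the bounds up to `k` (Mathlib
`contDiff_of_differentiable_iteratedDeriv`). [folklore] -/
theorem contDiff_line {G : ℂ → ℂ} {c : ℝ} {M : ℕ → ℝ} {k : ℕ} (hc : 0 < c)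
    (hGc : Continuous fun s : ℝ => G ((c : ℂ) + (s : ℂ) * I))
    (hGb : ∀ j : ℕ, j ≤ k → ∀ s : ℝ, ‖((c : ℂ) + (s : ℂ) * I) ^ j * G ((c : ℂ) + (s : ℂ) * I)‖ ≤ M j / (c ^ 2 + s ^ 2))
    {j : ℕ} (hj : j < k) :
    ContDiff ℝ j (fun t : ℝ => ∫ s : ℝ, cexp ((t : ℂ) * ((c : ℂ) + (s : ℂ) * I)) * G ((c : ℂ) + (s : ℂ) * I)) := by
  refine contDiff_of_differentiable_iteratedDeriv fun m hm => ?_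
  have hm' : m ≤ j := by exact_mod_cast hm
  exact differentiable_iteratedDeriv_line hc hGc hGb (lt_of_le_of_lt hm' hj)

end

end Summit.QuantumFields.BalabanUV.Beta.EriceFlowEnclosureBorelTransformDeriv
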